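import Mathlib.Algebra.MvPolynomial.Funext
import Literature.NumberTheory.Transcendental.MahlerManin
import Literature.NumberTheory.EllipticCurves.QSeriesDisc
import HarnessLib

/-!
# `X` and `X·J(X)` are algebraically independent over `ℂ`: proof of `FormalXJTranscendental`

Everything in this file is **proved**; there are no new definitions.  We discharge the named fact
`Literature.NumberTheory.Transcendental.FormalXJTranscendental` (`MahlerManin.lean`;
Barré-Sirieix–Diaz–Gramain–Philibert 1996, Lemme 4 = Nesterenko–Philippon LNM 1752, Ch. 2,
Lemma 2.7: "the formal series `J ∈ ℂ((X))` is transcendental over `ℂ(X)`"), vendored there as the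
algebraic independence over `ℂ` of `X` and `X·J(X) = formalXJ ∈ ℤ⟦X⟧ ⊂ ℂ⟦X⟧`:

* `FormalXJTranscendental_holds : FormalXJTranscendental`.

## Proof

The printed proofs argue with the modular equations of unbounded degree or with the natural
boundary of `J`; we use instead the modular invariance of `j`, now available in the tree.  Let
`A ∈ ℂ[X₁, X₂]` with `A(X, X·J(X)) = 0` in `ℂ⟦X⟧`.

1. (`eval_qParam_kleinJ_eq_zero`) The series `A(X, X·J(X))` lies in the subring `𝒮` of series
   absolutely convergent on the unit disc (`discSeries`, `QSeriesDisc.lean`), and the evaluation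
   homomorphism at `q = q(τ) = e^{2πiτ}` (`evalDisc`) maps it to `A(q(τ), q(τ) j(τ))`, because
   `Σ cₙ q(τ)ⁿ = q(τ) j(τ)` for the integer `q`-expansion `c = formalXJ` of `q·j`
   (`evalDisc_qParam_formalXJ`, from `hasSum_formalXJ` of `KleinJIntegralQExpansion.lean`, i.e.
   Cox Thm. 11.8).  Hence `A(q(τ), q(τ) j(τ)) = 0` for every `τ ∈ ℍ`.
2. (`eval_mul_kleinJ_eq_zero`) Fix `τ₀`.  For `γₙ = S Tⁿ ∈ SL₂(ℤ)` one has `j(γₙτ₀) = j(τ₀)`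
   (`kleinJ_smul`) while `Im(γₙτ₀) = Im τ₀ / |τ₀ + n|²` takes infinitely many values, so the
   one-variable polynomial `A(T, T·j(τ₀))` has infinitely many roots `q(γₙτ₀)` and vanishes:
   `A(t, t·j(τ₀)) = 0` for all `t ∈ ℂ`.
3. (`FormalXJTranscendental_holds`) Since `j : ℍ → ℂ` is surjective (`kleinJ_surjective`),
   `A(t, t·y) = 0` for all `t, y ∈ ℂ`, hence `A(x, y) = 0` for all `x ≠ 0` and all `y`, hence for
   all `(x, y)` (a polynomial in `x` with infinitely many roots), so `A = 0`
   (`MvPolynomial.funext`).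

## References

* [BarreSirieixDiazGramainPhilibert1996Manin] K. Barré-Sirieix, G. Diaz, F. Gramain,
  G. Philibert, *Une preuve de la conjecture de Mahler–Manin*, Invent. Math. 124 (1996) 1–9,
  Lemme 4.
* [NesterenkoPhilippon2001] Yu. V. Nesterenko, P. Philippon (eds.), LNM 1752, Springer 2001,
  Ch. 2 (G. Diaz), Lemma 2.7.
* D. A. Cox, *Primes of the form x² + ny²*, 2nd ed., Wiley 2013, Thm. 11.2 (`j(γτ) = j(τ)`),
  Thm. 11.8 (`j = 1/q + Σ cₙ qⁿ`, `cₙ ∈ ℤ`). [Cox2013]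
-/

noncomputable section

open Complex PowerSeries Polynomial
open UpperHalfPlane hiding I
open scoped MatrixGroups Real

namespace Literature.NumberTheory.Transcendental

open Literature.NumberTheory.EllipticCurves Literature.NumberTheory.EllipticCurves.ModularForms

/-! ### Step 1: evaluation of `A(X, X·J(X))` at `q(τ)` -/

/-- For `A ∈ ℂ[X₁, X₂]`, the power series `A(X, X·J(X)) ∈ ℂ⟦X⟧` lies in the subring `𝒮` of series
absolutely convergent on the unit disc, and its value at `q(τ)`, `τ ∈ ℍ`, is
`A(q(τ), q(τ)·j(τ))`. [folklore] -/
theorem exists_discSeries_coe_eq_aeval (A : MvPolynomial (Fin 2) ℂ) :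
    ∃ P : discSeries,
      (P : PowerSeries ℂ) =
          MvPolynomial.aeval ![(X : PowerSeries ℂ), PowerSeries.map (Int.castRingHom ℂ) formalXJ] A ∧
        ∀ τ : ℍ, evalDisc (Function.Periodic.qParam 1 τ) (norm_qParam_one_lt_one τ) P =
          MvPolynomial.eval
            ![Function.Periodic.qParam 1 τ, Function.Periodic.qParam 1 τ * kleinJ τ] A := by
  -- the coefficient embedding `ℂ → 𝒮` and the two generators `X`, `X·J(X)` of `𝒮`
  let Cd : ℂ →+* discSeries := (PowerSeries.C (R := ℂ)).codRestrict discSeries C_mem_discSeries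
  let xs : Fin 2 → discSeries :=
    ![⟨X, X_mem_discSeries⟩, ⟨PowerSeries.map (Int.castRingHom ℂ) formalXJ, map_formalXJ_mem_discSeries⟩]
  refine ⟨MvPolynomial.eval₂ Cd xs A, ?_, fun τ ↦ ?_⟩
  · have h := MvPolynomial.eval₂_comp_left discSeries.subtype Cd xs A
    rw [MvPolynomial.aeval_def]
    have hC : discSeries.subtype.comp Cd = algebraMap ℂ (PowerSeries ℂ) := by
      ext a
      · simp [Cd, PowerSeries.C_eq_algebraMap]
    have hx : (discSeries.subtype ∘ xs) =
        ![(X : PowerSeries ℂ), PowerSeries.map (Int.castRingHom ℂ) formalXJ] := by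
      ext i
      fin_cases i <;> rfl
    rw [← hC, ← hx, ← h]
    rfl
  · have h := MvPolynomial.eval₂_comp_left
      (evalDisc (Function.Periodic.qParam 1 τ) (norm_qParam_one_lt_one τ)) Cd xs A
    rw [h]
    have hC : (evalDisc (Function.Periodic.qParam 1 τ) (norm_qParam_one_lt_one τ)).comp Cd =
        RingHom.id ℂ := by
      ext a
      simp only [RingHom.coe_comp, Function.comp_apply, RingHom.id_apply]
      exact evalDisc_C (norm_qParam_one_lt_one τ) a
    have hx : ((evalDisc (Function.Periodic.qParam 1 τ) (norm_qParam_one_lt_one τ)) ∘ xs) =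
        ![Function.Periodic.qParam 1 τ, Function.Periodic.qParam 1 τ * kleinJ τ] := by
      ext i
      fin_cases i
      · exact evalDisc_X (norm_qParam_one_lt_one τ)
      · exact evalDisc_qParam_formalXJ τ
    rw [hC, hx]
    rfl

/-- **`A(X, X·J(X)) = 0` in `ℂ⟦X⟧` forces `A(q(τ), q(τ) j(τ)) = 0` for every `τ ∈ ℍ`**
(evaluate the absolutely convergent series at `q(τ)`, Cox Thm. 11.8). [folklore] -/
theorem eval_qParam_kleinJ_eq_zero {A : MvPolynomial (Fin 2) ℂ}
    (hA : MvPolynomial.aeval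
      ![(X : PowerSeries ℂ), PowerSeries.map (Int.castRingHom ℂ) formalXJ] A = 0) (τ : ℍ) :
    MvPolynomial.eval ![Function.Periodic.qParam 1 τ, Function.Periodic.qParam 1 τ * kleinJ τ] A = 0 := by
  obtain ⟨P, hP, hev⟩ := exists_discSeries_coe_eq_aeval A
  have hP0 : P = 0 := Subtype.ext (by rw [hP, hA]; rfl)
  rw [← hev τ, hP0, map_zero]

/-! ### Step 2: the orbit of `τ₀` under `S Tⁿ` and the vanishing of `A(T, T·j(τ₀))` -/

/-- `det (0 −1; 1 n) = 1`. [folklore] -/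
theorem sl2z_det_aux (n : ℤ) : (0 : ℤ) * n - (-1) * 1 = 1 := by
  rw [zero_mul, zero_sub, neg_mul, one_mul, neg_neg]

/-- The matrices `γₙ = S Tⁿ = (0 −1; 1 n) ∈ SL₂(ℤ)` act by `τ ↦ −1/(τ + n)`, so
`Im(γₙ τ) = Im τ / |τ + n|²`. [folklore] -/
theorem im_sl2zMk_S_T_pow_smul (n : ℤ) (τ : ℍ) :
    (sl2zMk 0 (-1) 1 n (sl2z_det_aux n) • τ).im = τ.im / Complex.normSq ((τ : ℂ) + n) := by
  rw [ModularGroup.im_smul_eq_div_normSq, ModularGroup.denom_apply]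
  congr 2
  simp [sl2zMk]

/-- `|τ + n|² = (Re τ + n)² + (Im τ)²` is strictly increasing in `n ≥ -Re τ`; in particular the
values `Im(γₙ τ)`, `n ≥ ⌈-Re τ⌉`, are pairwise distinct. [folklore] -/
theorem normSq_coe_add_natCast_strictMono (τ : ℍ) :
    StrictMono fun n : ℕ ↦ Complex.normSq ((τ : ℂ) + ((⌈-(τ : ℂ).re⌉ : ℤ) + (n : ℤ) : ℤ)) := by
  refine strictMono_nat_of_lt_succ fun n ↦ ?_
  simp only [Complex.normSq_apply, Complex.add_re, Complex.intCast_re, Complex.add_im,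
    Complex.intCast_im, add_zero]
  have h0 : (0 : ℝ) ≤ (τ : ℂ).re + ((⌈-(τ : ℂ).re⌉ : ℤ) : ℝ) := by
    have := Int.le_ceil (-(τ : ℂ).re)
    linarith
  push_cast
  nlinarith

/-- The points `q(γₙ τ₀) = e^{2πi γₙτ₀}`, `γₙ = S Tⁿ`, `n ≥ ⌈-Re τ₀⌉`, are pairwise distinct (their
absolute values `e^{-2π Im(γₙτ₀)}` are). [folklore] -/
theorem injective_qParam_orbit (τ : ℍ) :
    Function.Injective fun n : ℕ ↦ Function.Periodic.qParam 1
      ((sl2zMk 0 (-1) 1 ((⌈-(τ : ℂ).re⌉ : ℤ) + (n : ℤ)) (sl2z_det_aux _) • τ : ℍ) : ℂ) := by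
  intro n m hnm
  have h := congrArg (fun z : ℂ ↦ ‖z‖) hnm
  simp only [Function.Periodic.norm_qParam, div_one, UpperHalfPlane.coe_im] at h
  -- `h : exp (-2π Im(γₙ τ)) = exp (-2π Im(γₘ τ))`
  have h' : (sl2zMk 0 (-1) 1 ((⌈-(τ : ℂ).re⌉ : ℤ) + (n : ℤ)) (sl2z_det_aux _) • τ).im =
      (sl2zMk 0 (-1) 1 ((⌈-(τ : ℂ).re⌉ : ℤ) + (m : ℤ)) (sl2z_det_aux _) • τ).im := by
    have := Real.exp_injective h
    have hπ : (-2 * Real.pi) ≠ 0 := by positivity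
    exact mul_left_cancel₀ hπ this
  rw [im_sl2zMk_S_T_pow_smul, im_sl2zMk_S_T_pow_smul] at h'
  have hpos : ∀ k : ℤ, 0 < Complex.normSq ((τ : ℂ) + k) := fun k ↦ by
    rw [Complex.normSq_pos]
    intro h0
    have := congrArg Complex.im h0
    simp [τ.im_pos.ne'] at this
  rw [div_eq_div_iff (hpos _).ne' (hpos _).ne', mul_eq_mul_left_iff, or_iff_left τ.im_pos.ne']
    at h'
  exact (normSq_coe_add_natCast_strictMono τ).injective h'.symm

/-- **`A(t, t·j(τ₀)) = 0` for all `t ∈ ℂ`**, once `A(q(τ), q(τ) j(τ)) = 0` on `ℍ`: the polynomial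
`A(T, T·j(τ₀)) ∈ ℂ[T]` vanishes at the infinitely many points `q(γₙτ₀)` (`j(γₙτ₀) = j(τ₀)`,
Cox Thm. 11.2). [folklore] -/
theorem eval_mul_kleinJ_eq_zero {A : MvPolynomial (Fin 2) ℂ}
    (hA : ∀ τ : ℍ, MvPolynomial.eval
      ![Function.Periodic.qParam 1 τ, Function.Periodic.qParam 1 τ * kleinJ τ] A = 0)
    (τ₀ : ℍ) (t : ℂ) : MvPolynomial.eval ![t, t * kleinJ τ₀] A = 0 := by
  -- the one-variable polynomial `B(T) = A(T, T·j(τ₀))`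
  set B : Polynomial ℂ := MvPolynomial.aeval ![(Polynomial.X : Polynomial ℂ),
    Polynomial.X * Polynomial.C (kleinJ τ₀)] A with hB
  have hBeval : ∀ s : ℂ, B.eval s = MvPolynomial.eval ![s, s * kleinJ τ₀] A := by
    intro s
    rw [hB, MvPolynomial.aeval_def, ← Polynomial.coe_evalRingHom, MvPolynomial.eval₂_comp_left]
    have hC : (Polynomial.evalRingHom s).comp (algebraMap ℂ (Polynomial ℂ)) = RingHom.id ℂ := by
      ext a
      simp
    have hx : ((Polynomial.evalRingHom s) ∘ ![(Polynomial.X : Polynomial ℂ),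
        Polynomial.X * Polynomial.C (kleinJ τ₀)]) = ![s, s * kleinJ τ₀] := by
      ext i
      fin_cases i
      · simp
      · simp [mul_comm (kleinJ τ₀)]
    rw [hC, hx]
    rfl
  -- `B` vanishes on the orbit points `q(γ τ₀)`
  have hroots : ∀ γ : SL(2, ℤ), B.IsRoot (Function.Periodic.qParam 1 ((γ • τ₀ : ℍ) : ℂ)) := by
    intro γ
    rw [Polynomial.IsRoot, hBeval, ← kleinJ_smul γ τ₀]
    exact hA (γ • τ₀)
  have hinf : Set.Infinite {x : ℂ | B.IsRoot x} :=
    Set.infinite_of_injective_forall_mem (injective_qParam_orbit τ₀) fun n ↦ hroots _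
  have hB0 : B = 0 := Polynomial.eq_zero_of_infinite_isRoot B hinf
  rw [← hBeval, hB0, Polynomial.eval_zero]

/-! ### Step 3: conclusion -/

/-- A polynomial `A ∈ ℂ[X₁, X₂]` with `A(t, t·y) = 0` for all `t, y ∈ ℂ` is zero. [folklore] -/
theorem mvPolynomial_eq_zero_of_eval_mul_eq_zero {A : MvPolynomial (Fin 2) ℂ}
    (hA : ∀ t y : ℂ, MvPolynomial.eval ![t, t * y] A = 0) : A = 0 := by
  -- `A(x, y) = 0` for `x ≠ 0`
  have h1 : ∀ x y : ℂ, x ≠ 0 → MvPolynomial.eval ![x, y] A = 0 := by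
    intro x y hx
    have := hA x (y / x)
    rwa [mul_div_cancel₀ _ hx] at this
  -- hence for all `x`, by the identity theorem for the polynomial `x ↦ A(x, y)`
  have h2 : ∀ x y : ℂ, MvPolynomial.eval ![x, y] A = 0 := by
    intro x y
    set B : Polynomial ℂ := MvPolynomial.aeval ![(Polynomial.X : Polynomial ℂ),
      Polynomial.C y] A with hB
    have hBeval : ∀ s : ℂ, B.eval s = MvPolynomial.eval ![s, y] A := by
      intro s
      rw [hB, MvPolynomial.aeval_def, ← Polynomial.coe_evalRingHom, MvPolynomial.eval₂_comp_left]
      have hC : (Polynomial.evalRingHom s).comp (algebraMap ℂ (Polynomial ℂ)) = RingHom.id ℂ := by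
        ext a
        simp
      have hx : ((Polynomial.evalRingHom s) ∘ ![(Polynomial.X : Polynomial ℂ), Polynomial.C y]) =
          ![s, y] := by
        ext i
        fin_cases i <;> simp
      rw [hC, hx]
      rfl
    have hinf : Set.Infinite {x : ℂ | B.IsRoot x} := by
      refine (Set.infinite_of_finite_compl (s := {x : ℂ | x ≠ 0}) ?_).mono fun x hx ↦ ?_
      · convert Set.finite_singleton (0 : ℂ) using 1
        ext x
        simp
      · rw [Set.mem_setOf_eq, Polynomial.IsRoot, hBeval]
        exact h1 x y hx
    have hB0 : B = 0 := Polynomial.eq_zero_of_infinite_isRoot B hinf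
    rw [← hBeval, hB0, Polynomial.eval_zero]
  refine MvPolynomial.funext fun v ↦ ?_
  rw [map_zero]
  have hv : v = ![v 0, v 1] := by
    ext i
    fin_cases i <;> rfl
  rw [hv]
  exact h2 (v 0) (v 1)

/-- **`X` and `X·J(X)` are algebraically independent over `ℂ`** (equivalently: the formal series
`J ∈ ℂ((X))` is transcendental over `ℂ(X)`; Barré-Sirieix–Diaz–Gramain–Philibert 1996, Lemme 4 =
Nesterenko–Philippon LNM 1752, Ch. 2, Lemma 2.7): discharge of the named fact
`FormalXJTranscendental`. [cite: NesterenkoPhilippon2001, Ch. 2, Lemma 2.7] -/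
theorem FormalXJTranscendental_holds : FormalXJTranscendental := by
  rw [FormalXJTranscendental, algebraicIndependent_iff]
  intro A hA
  refine mvPolynomial_eq_zero_of_eval_mul_eq_zero fun t y ↦ ?_
  obtain ⟨τ₀, rfl⟩ := kleinJ_surjective y
  exact eval_mul_kleinJ_eq_zero (eval_qParam_kleinJ_eq_zero hA) τ₀ t

end Literature.NumberTheory.Transcendental

end
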